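import Summits.CriticalPhenomena.PercolationContinuityZ3.Theorems.PercNearOneGluingNoHeavyLowerTailFKHullPortMDLX
import Summits.CriticalPhenomena.PercolationContinuityZ3.Theorems.PercNearOneGluingNoHeavyLowerTailFKHullPortTALayer
import HarnessLib

/-!
# FK sub-lane: MDL(X) for `φ_{𝐩,q}` unconditional at every parameter vector

Support file (`--supports stmt-CriticalPhenomena-4575`), FK sub-lane `prim-bschramm-fk-2` (gen 3); builds on p205010 (kernel theorem,
internal audit signed; external expert review pending).  No definitions, no named facts, no sorries; standard axioms.

`FK.markerDominanceAvoid_rc_all`: the marker-dominance lemma with avoidance (CSH level 0) for the random-cluster measure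
`rcMeasureW w q ∅`, `q ≥ 1`, for EVERY `w : Sym2 V → [0,1]` — prim-cplus-literature's `FK.markerDominanceAvoid_of_Pv_rc`
(`…FKHullPortMDLX.lean`: reduction theorem `BHK2006_twoMarkerCov_le_of_within_rc_of_forall_nondegenerate` + continuity in the
parameters) with `hPv` supplied by `FK.taB_singleton_le_of_monotone` (`…FKHullPortTALayer.lean`).  bschramm/FK-Q2.md §12.6(b), §12.9.
[cite: VandenbergHaggstromKahn2005, Thm. 1.3 (p. 6), Thm. 2.1 (p. 9), §2.1 pp. 10–13] [cite: Grimmett2006, Thm. (3.8)(b) (p. 39)]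
[cite: Gladkov2024, Thm. 3.2 (p. 4)]
-/

noncomputable section

namespace Summit.CriticalPhenomena.PercolationContinuityZ3.Theorems.FK

open MeasureTheory Set
open Literature.Probability.LatticeModels Literature.Probability.Percolation
open scoped Classical

variable {V : Type*} [Fintype V]

/-! ### MDL(X) for `φ_{𝐩,q}` — unconditional, every parameter vector -/

/-- **MDL(X) for the random-cluster measure `φ_{𝐩,q}`, `q ≥ 1`, EVERY parameter vector `w`, every avoided set `X`,
every monotone `F` — unconditional** (bschramm/FK-Q2.md §12.6(b)): prim-cplus-literature's
`FK.markerDominanceAvoid_of_Pv_rc` (reduction theorem for `φ_{𝐩,q}` + continuity closure over degenerate parameters) with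
its hypothesis `hPv` discharged by `FK.taB_singleton_le_of_monotone` (Lemma `P_v` for `φ_{𝐩,q}`, this cell).  Compared with
`FK.markerDominanceAvoid_rc` no non-degeneracy hypothesis on the parameters at `X` is needed.
[cite: VandenbergHaggstromKahn2005, Thm. 1.3 (p. 6), Thm. 2.1 (p. 9), §2.1 pp. 10–13] [cite: Grimmett2006, Thm. (3.8)(b) (p. 39)]
[cite: Gladkov2024, Thm. 3.2 (p. 4)] -/
theorem markerDominanceAvoid_rc_all {q : ℝ} (hq : 1 ≤ q) (w : Sym2 V → unitInterval) (s y z : V) (X : Set V)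
    (hsy : s ≠ y) (F : Set (Sym2 V) → ℝ) (hF : Monotone F) :
    (rcMeasureW w q ∅).real ({ω : BondConfig V | ∀ x ∈ insert s X, ¬ (openGraph ω).Reachable y x} ∩ openConn y z) *
        ((rcMeasureW w q ∅).real {ω : BondConfig V | ∀ x ∈ X, ¬ (openGraph ω).Reachable s x} *
            (∫ ω in {ω : BondConfig V | ∀ x ∈ X, ¬ (openGraph ω).Reachable s x} ∩ openConn s y,
              F (openEdgeCluster ω s) ∂(rcMeasureW w q ∅)) -
          (∫ ω in {ω : BondConfig V | ∀ x ∈ X, ¬ (openGraph ω).Reachable s x},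
              F (openEdgeCluster ω s) ∂(rcMeasureW w q ∅)) *
            (rcMeasureW w q ∅).real ({ω : BondConfig V | ∀ x ∈ X, ¬ (openGraph ω).Reachable s x} ∩ openConn s y)) ≤
      (rcMeasureW w q ∅).real {ω : BondConfig V | ∀ x ∈ insert s X, ¬ (openGraph ω).Reachable y x} *
        ((rcMeasureW w q ∅).real {ω : BondConfig V | ∀ x ∈ X, ¬ (openGraph ω).Reachable s x} *
            (∫ ω in {ω : BondConfig V | ∀ x ∈ X, ¬ (openGraph ω).Reachable s x} ∩ openConn s z,
              F (openEdgeCluster ω s) ∂(rcMeasureW w q ∅)) -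
          (∫ ω in {ω : BondConfig V | ∀ x ∈ X, ¬ (openGraph ω).Reachable s x},
              F (openEdgeCluster ω s) ∂(rcMeasureW w q ∅)) *
            (rcMeasureW w q ∅).real ({ω : BondConfig V | ∀ x ∈ X, ¬ (openGraph ω).Reachable s x} ∩ openConn s z)) :=
  markerDominanceAvoid_of_Pv_rc hq w s y z X hsy
    (fun g hg _ u v' => taB_singleton_le_of_monotone u hq hsy v' g hg) F hF

end Summit.CriticalPhenomena.PercolationContinuityZ3.Theorems.FK

end
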